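import Summits.Ventures.HodgeRepro2.T5FinitePlaceSplitProduct
import Summits.Ventures.HodgeRepro2.T5FinitePlaceGaloisTransport
import Summits.Ventures.HodgeRepro2.T5FinitePlaceStar

/-!
# At a split place the complex conjugation swaps the two factors of `K⁺_v ⊗ K ≅ K_w × K_{w'}`
(cell pub-hodge-repro2, seat p3)

Tier-5 N2 support, §N2.9.2 of route/T5-N2-route-3.md («completions») at the finite places — the last piece of the
local picture of the CM involution: at a SPLIT place `v` of `K⁺` with the two primes `w`, `w' = c • w` of `K` above it,
under the product decomposition `prodLift : K⁺_v ⊗[K⁺] K → K_w × K_{w'}` (file 127) the conjugation `1 ⊗ c` of the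
tensor product corresponds to the SWAP composed with the Galois transports `K_w ≃ K_{w'}` (file 129):
`prodLift ((1 ⊗ c) z) = (transport_{w' → w} (prodLift z).2, transport_{w → w'} (prodLift z).1)`
(`prodLift_conjTensor`). This is «`E_v = E_w × E_{w'}` with `c` exchanging the factors», the reason the local
unitary group at a split place is a general linear group (row N2.2.2's split case). Mathlib + files 115–129 only.
No display; no device. §8(d): uses an L-value-free non-vanishing device: NO.
-/

namespace Summit.Ventures.HodgeRepro2.T5FinitePlaceSplitConj

open IsDedekindDomain IsDedekindDomain.HeightOneSpectrum NumberField NumberField.IsCMField Module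
open scoped Summit.Ventures.HodgeRepro2.T5FinitePlaceLiesOver TensorProduct Pointwise
open Summit.Ventures.HodgeRepro2.T5FinitePlaceLiesOver Summit.Ventures.HodgeRepro2.T5FinitePlaceSplitProduct
  Summit.Ventures.HodgeRepro2.T5FinitePlaceGaloisTransport Summit.Ventures.HodgeRepro2.T5FinitePlaceStar

variable (K : Type*) [Field K] [NumberField K] [IsCMField K]
variable (v : HeightOneSpectrum (𝓞 (maximalRealSubfield K))) (w w' : HeightOneSpectrum (𝓞 K))
  [w.asIdeal.LiesOver v.asIdeal] [w'.asIdeal.LiesOver v.asIdeal]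
variable (hw : complexConj K • w.asIdeal = w'.asIdeal)

/-- `c • c = 1` on ideals: `c • w' = w` when `c • w = w'`. -/
theorem complexConj_smul_eq (hw : complexConj K • w.asIdeal = w'.asIdeal) :
    complexConj K • w'.asIdeal = w.asIdeal := by
  rw [← hw, smul_smul]
  have h : complexConj K * complexConj K = 1 := by
    ext x
    exact complexConj_apply_apply K x
  rw [h, one_smul]

/-- The conjugation `1 ⊗ c` of `K⁺_v ⊗[K⁺] K` (file 117's `Algebra.TensorProduct.congr` on the `K`-factor). -/
noncomputable def conjTensor :
    (v.adicCompletion (maximalRealSubfield K)) ⊗[maximalRealSubfield K] K ≃ₐ[v.adicCompletion (maximalRealSubfield K)]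
      (v.adicCompletion (maximalRealSubfield K)) ⊗[maximalRealSubfield K] K :=
  Algebra.TensorProduct.congr (AlgEquiv.refl : (v.adicCompletion (maximalRealSubfield K)) ≃ₐ[v.adicCompletion
    (maximalRealSubfield K)] (v.adicCompletion (maximalRealSubfield K))) (complexConj K)

/-- `conjTensor (a ⊗ x) = a ⊗ c x`. -/
theorem conjTensor_tmul (a : v.adicCompletion (maximalRealSubfield K)) (x : K) :
    conjTensor K v (a ⊗ₜ x) = a ⊗ₜ complexConj K x := by
  simp [conjTensor]

include hw in
/-- **The conjugation swaps the two factors:** under `prodLift`, `1 ⊗ c` is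
`(z₁, z₂) ↦ (transport_{w' → w} c z₂, transport_{w → w'} c z₁)`. -/
theorem prodLift_conjTensor (z : (v.adicCompletion (maximalRealSubfield K)) ⊗[maximalRealSubfield K] K) :
    prodLift K v w w' (conjTensor K v z) =
      (transport w' w (complexConj K) (complexConj_smul_eq K w w' hw) (prodLift K v w w' z).2,
        transport w w' (complexConj K) hw (prodLift K v w w' z).1) := by
  induction z using TensorProduct.induction_on with
  | zero =>
    simp only [map_zero, Prod.snd_zero, Prod.fst_zero]
    rfl
  | add x y hx hy =>
    rw [map_add, map_add, hx, hy, map_add, Prod.snd_add, Prod.fst_add, map_add, map_add]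
    rfl
  | tmul a x =>
    rw [conjTensor_tmul]
    simp only [prodLift, AlgHom.prod_apply, tensorLift_tmul, map_mul]
    rw [transport_algebraMap_left w' w (complexConj K) _ v, transport_algebraMap_left w w' (complexConj K) hw v]
    congr 1
    · rw [show algebraMap K (w'.adicCompletion K) x = (x : w'.adicCompletion K) from rfl, transport_coe]
      rfl
    · rw [show algebraMap K (w.adicCompletion K) x = (x : w.adicCompletion K) from rfl, transport_coe]
      rfl

end Summit.Ventures.HodgeRepro2.T5FinitePlaceSplitConj
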